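import Summits.AtomisticToContinuum.BoseEinsteinCondensation.Theorems.BECSubharmonicContinuationCoreContinuationBallSlices
import Mathlib.MeasureTheory.Integral.DominatedConvergence
import Mathlib.Analysis.Normed.Group.FunctionSeries
import Mathlib.MeasureTheory.Integral.Average
import HarnessLib

/-!
# Route `BECSubharmonicContinuation` — the harmonic minorant, abstract form (helper for
# `CoreContinuation`, stmt-AtomisticToContinuum-14570)

For an absolutely convergent cosine series `G(y) = ∑ₙ aₙ cos(κₙ·y)` with `aₙ ≥ 0`, `∑ aₙ = 1`, its
"kinetic" companion `H(y) = ∑ₙ aₙ|κₙ|² cos(κₙ·y)` (`= -ΔG`), and radii `0 < R ≤ S`, GIVEN the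
per-mode ball Green identity `|k|²∫_{B_S} cos(k·y) K_S(|y|) dy = 1 - ⨍_{B_S} cos(k·y)`
(`K_S(s) = (4π)⁻¹(1/s - 3/(2S) + s²/(2S³))`, proved in `…CoreContinuationBallGreenIdentity.lean`),
`harmonicMinorant_of_hasSum` proves

`1 - ⨍_{B(0,S)} G ≤ (4π)⁻¹∫_{B(0,R)} H/|y| + H(0)R³/S + (4π)⁻¹∫_{R ≤ |y| ≤ S} H₊/|y|`.

Summing the identity over the modes (dominated convergence: `K_S ∈ L¹(B_S)`,
`∑ aₙ|κₙ|² = H(0)`) gives the coherence–potential identity `1 - ⨍_{B_S} G = ∫_{B_S} H K_S`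
(the deficit of the window IS the Newtonian-type potential at the origin of the charge `H`); on the
core `B_R` the bounds `|K_S - 1/(4π|y|)| ≤ 3/(8πS)`, `|H| ≤ H(0)` cost at most `H(0)R³/(2S)`, on
the shell `0 ≤ K_S ≤ 1/(4π|y|)` and `H ≤ H₊`. This is the abstract content of the route's support
`HarmonicMinorant`; the instantiation with the momentum representation of a periodic trial state
is in `…CoreContinuationHarmonicMinorant.lean`.

## References

* D. Gilbarg, N. S. Trudinger, *Elliptic Partial Differential Equations of Second Order*,
  Springer 2001, §2.4–2.5 (Green's representation, Green's function of the ball). [GilbargTrudinger2001]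
* V. Bargmann, *On the number of bound states in a central field of force*, PNAS 38 (1952) 961
  (potential-at-the-origin bookkeeping). [Bargmann1952]
-/

noncomputable section

open MeasureTheory Set Real Metric
open scoped BigOperators RealInnerProductSpace

namespace Summit.AtomisticToContinuum.BoseEinsteinCondensation.Theorems.CoreContinuationKernel

open Literature.Analysis.FluidPDE
open Literature.MathematicalPhysics.QuantumManyBody.BoseGas (Space)
open Summit.AtomisticToContinuum.BoseEinsteinCondensation.Theorems.CoreDeficitBounds

/-! ### The harmonic minorant, abstract form -/

section Minorant

variable {ι : Type*} [Countable ι]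

omit [Countable ι] in
/-- The phase of a plane wave is continuous. [folklore] -/
theorem continuous_cos_phase (κ : ι → Space) (n : ι) :
    Continuous fun y : Space => Real.cos (∑ j, κ n j * y j) :=
  Real.continuous_cos.comp (continuous_finsetSum _ fun j _ =>
    continuous_const.mul (PiLp.continuous_apply 2 (fun _ : Fin 3 => ℝ) j))

/-- **The harmonic minorant, abstract form.** Let `G(y) = ∑ₙ aₙ cos(κₙ·y)` and
`H(y) = ∑ₙ aₙ|κₙ|² cos(κₙ·y)` (`= -ΔG`) be absolutely convergent cosine series with weights
`aₙ ≥ 0`, `∑ₙ aₙ = 1`, and suppose the per-mode ball Green identity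
`|k|²∫_{B_S} cos(k·y) K_S(|y|) dy = 1 - ⨍_{B_S} cos(k·y)` for all `k`. Then for `0 < R ≤ S`,
`1 - ⨍_{B(0,S)} G ≤ (4π)⁻¹∫_{B(0,R)} H/|y| + H(0)R³/S + (4π)⁻¹∫_{R ≤ |y| ≤ S} H₊/|y|`.
Proof: summing the identity over the modes (dominated convergence, `K_S ∈ L¹(B_S)`,
`∑ aₙ|κₙ|² = H(0)`) gives `1 - ⨍_{B_S} G = ∫_{B_S} H K_S`; on the core `B_R`,
`|K_S - 1/(4π|y|)| ≤ 3/(8πS)` and `|H| ≤ H(0)` cost at most `H(0)R³/(2S)`; on the shell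
`0 ≤ K_S ≤ 1/(4π|y|)` and `H ≤ H₊`. [cite: GilbargTrudinger2001, §2.4–2.5; Bargmann1952] -/
theorem harmonicMinorant_of_hasSum {a : ι → ℝ} (ha0 : ∀ n, 0 ≤ a n) (hasum : HasSum a 1)
    (κ : ι → Space) {Gf Hf : Space → ℝ}
    (hG : ∀ y, HasSum (fun n => a n * Real.cos (∑ j, κ n j * y j)) (Gf y))
    (hH : ∀ y, HasSum (fun n => a n * ‖κ n‖ ^ 2 * Real.cos (∑ j, κ n j * y j)) (Hf y))
    {R S : ℝ} (hR : 0 < R) (hRS : R ≤ S)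
    (hPM : ∀ k : Space, ‖k‖ ^ 2 * ∫ y in ball (0 : Space) S, Real.cos (∑ j, k j * y j) *
        ((4 * π)⁻¹ * (‖y‖⁻¹ - 3 / (2 * S) + ‖y‖ ^ 2 / (2 * S ^ 3))) =
      1 - ⨍ y in ball (0 : Space) S, Real.cos (∑ j, k j * y j)) :
    1 - (⨍ y in ball (0 : Space) S, Gf y) ≤
      (4 * π)⁻¹ * (∫ y in ball (0 : Space) R, Hf y / ‖y‖) + Hf 0 * R ^ 3 / S +
        (4 * π)⁻¹ * (∫ y in {y : Space | R ≤ ‖y‖ ∧ ‖y‖ ≤ S}, max (Hf y) 0 / ‖y‖) := by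
  have hS : 0 < S := hR.trans_le hRS
  have hπ : 0 < π := Real.pi_pos
  -- the kinetic weights `wₙ = aₙ|κₙ|²`, `∑ wₙ = H(0)`
  set w : ι → ℝ := fun n => a n * ‖κ n‖ ^ 2 with hw
  have hw0 : ∀ n, 0 ≤ w n := fun n => mul_nonneg (ha0 n) (sq_nonneg _)
  have hH0 : HasSum w (Hf 0) := by
    refine (hH 0).congr_fun fun n => ?_
    simp [hw]
  have hHf0 : 0 ≤ Hf 0 := hH0.nonneg hw0
  -- `|H| ≤ H(0)`
  have hHle : ∀ y, Hf y ≤ Hf 0 := fun y =>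
    hasSum_le (fun n => mul_le_of_le_one_right (hw0 n) (Real.cos_le_one _)) (hH y) hH0
  have hHge : ∀ y, -Hf 0 ≤ Hf y := fun y => by
    refine hasSum_le (f := fun n => -w n) (fun n => ?_) hH0.neg (hH y)
    have := Real.neg_one_le_cos (∑ j, κ n j * y j)
    have h1 : w n * (-1) ≤ w n * Real.cos (∑ j, κ n j * y j) := mul_le_mul_of_nonneg_left this (hw0 n)
    simpa [hw] using h1
  have hHabs : ∀ y, |Hf y| ≤ Hf 0 := fun y => abs_le.2 ⟨hHge y, hHle y⟩
  -- `H` is continuous (uniformly convergent series), hence measurable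
  have hHc : Continuous Hf := by
    have h1 : Hf = fun y => ∑' n, w n * Real.cos (∑ j, κ n j * y j) :=
      funext fun y => (hH y).tsum_eq.symm
    rw [h1]
    refine continuous_tsum (fun n => continuous_const.mul (continuous_cos_phase κ n)) hH0.summable
      fun n y => ?_
    rw [norm_mul, Real.norm_eq_abs, Real.norm_eq_abs, abs_of_nonneg (hw0 n)]
    exact mul_le_of_le_one_right (hw0 n) (Real.abs_cos_le_one _)
  have hHm : Measurable Hf := hHc.measurable
  -- the kernel `K_S(y) = (4π)⁻¹(1/|y| - 3/(2S) + |y|²/(2S³))`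
  set KS : Space → ℝ := fun y => (4 * π)⁻¹ * (‖y‖⁻¹ - 3 / (2 * S) + ‖y‖ ^ 2 / (2 * S ^ 3)) with hKS
  have hKSm : Measurable KS := (measurable_ballKernel S).const_mul _
  have hKSint : IntegrableOn KS (ball (0 : Space) S) := (integrableOn_ballKernel hS).const_mul _
  -- (A) the window average in momentum space: `⨍_{B_S} G = ∑ aₙ ⨍_{B_S} cos(κₙ·y)`
  have hA : HasSum (fun n => a n * ⨍ y in ball (0 : Space) S, Real.cos (∑ j, κ n j * y j))
      (⨍ y in ball (0 : Space) S, Gf y) := by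
    have hDC := hasSum_integral_of_dominated_convergence
      (μ := volume.restrict (ball (0 : Space) S))
      (F := fun n y => a n * Real.cos (∑ j, κ n j * y j)) (f := Gf) (fun n _ => a n)
      (fun n => (continuous_const.mul (continuous_cos_phase κ n)).aestronglyMeasurable)
      (fun n => ae_of_all _ fun y => by
        rw [Real.norm_eq_abs, abs_mul, abs_of_nonneg (ha0 n)]
        exact mul_le_of_le_one_right (ha0 n) (Real.abs_cos_le_one _))
      (ae_of_all _ fun _ => hasum.summable)
      (by rw [hasum.tsum_eq]; exact integrableOn_const measure_ball_lt_top.ne)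
      (ae_of_all _ fun y => hG y)
    have hDC2 := hDC.mul_left ((volume : Measure Space).real (ball (0 : Space) S))⁻¹
    rw [setAverage_eq, smul_eq_mul]
    refine hDC2.congr_fun fun n => ?_
    rw [setAverage_eq, smul_eq_mul, MeasureTheory.integral_const_mul]
    ring
  -- (C) the Green identity summed over the modes: `∫_{B_S} H K_S = ∑ aₙ (1 - ⨍ cos(κₙ·y))`
  have hC : HasSum (fun n => a n * (1 - ⨍ y in ball (0 : Space) S, Real.cos (∑ j, κ n j * y j)))
      (∫ y in ball (0 : Space) S, Hf y * KS y) := by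
    have hDC := hasSum_integral_of_dominated_convergence
      (μ := volume.restrict (ball (0 : Space) S))
      (F := fun n y => (a n * ‖κ n‖ ^ 2 * Real.cos (∑ j, κ n j * y j)) * KS y)
      (f := fun y => Hf y * KS y) (fun n y => w n * |KS y|)
      (fun n => (((continuous_const.mul (continuous_cos_phase κ n)).measurable).mul
        hKSm).aestronglyMeasurable)
      (fun n => ae_of_all _ fun y => by
        rw [Real.norm_eq_abs, abs_mul, abs_mul, abs_of_nonneg (hw0 n)]
        exact mul_le_mul_of_nonneg_right (mul_le_of_le_one_right (hw0 n) (Real.abs_cos_le_one _))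
          (abs_nonneg _))
      (ae_of_all _ fun y => hH0.summable.mul_right _)
      (by
        have h1 : (fun y : Space => ∑' n, w n * |KS y|) = fun y => (∑' n, w n) * |KS y| := by
          funext y; exact tsum_mul_right
        rw [h1]
        exact hKSint.abs.const_mul _)
      (ae_of_all _ fun y => (hH y).mul_right (KS y))
    refine hDC.congr_fun fun n => ?_
    have hI : ∫ y in ball (0 : Space) S, a n * ‖κ n‖ ^ 2 * Real.cos (∑ j, κ n j * y j) * KS y =
        a n * (‖κ n‖ ^ 2 * ∫ y in ball (0 : Space) S, Real.cos (∑ j, κ n j * y j) * KS y) := by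
      rw [← MeasureTheory.integral_const_mul, ← MeasureTheory.integral_const_mul]
      refine integral_congr_ae (ae_of_all _ fun y => ?_)
      ring
    rw [hI, hKS, hPM (κ n)]
  -- (B) hence `1 - ⨍_{B_S} G = ∫_{B_S} H K_S`
  have hB : HasSum (fun n => a n * (1 - ⨍ y in ball (0 : Space) S, Real.cos (∑ j, κ n j * y j)))
      (1 - ⨍ y in ball (0 : Space) S, Gf y) := by
    refine (hasum.sub hA).congr_fun fun n => ?_
    ring
  have hkey : 1 - (⨍ y in ball (0 : Space) S, Gf y) = ∫ y in ball (0 : Space) S, Hf y * KS y :=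
    hB.unique hC
  rw [hkey]
  -- (D) position space: split the ball into the core `B_R` and the shell
  have hintS : IntegrableOn (fun y => Hf y * KS y) (ball (0 : Space) S) := by
    refine Integrable.mono' (hKSint.abs.const_mul (Hf 0)) ((hHm.mul hKSm).aestronglyMeasurable)
      (ae_of_all _ fun y => ?_)
    rw [Real.norm_eq_abs, abs_mul]
    exact mul_le_mul_of_nonneg_right (hHabs y) (abs_nonneg _)
  have hsplit : ∫ y in ball (0 : Space) S, Hf y * KS y = (∫ y in ball (0 : Space) R, Hf y * KS y) +
      ∫ y in ball (0 : Space) S \ ball 0 R, Hf y * KS y := by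
    rw [setIntegral_sdiff measurableSet_ball hintS (ball_subset_ball hRS)]
    ring
  -- (D1) the core
  have hcore : ∫ y in ball (0 : Space) R, Hf y * KS y ≤
      (4 * π)⁻¹ * (∫ y in ball (0 : Space) R, Hf y / ‖y‖) + Hf 0 * R ^ 3 / S := by
    set E : Space → ℝ := fun y => (4 * π)⁻¹ * ((‖y‖⁻¹ - 3 / (2 * S) + ‖y‖ ^ 2 / (2 * S ^ 3)) - ‖y‖⁻¹)
      with hE
    have hEm : Measurable E := ((measurable_ballKernel S).sub continuous_norm.measurable.inv).const_mul _
    have hEb : ∀ y ∈ ball (0 : Space) R, |E y| ≤ 3 / (8 * π * S) := by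
      intro y hy
      rw [mem_ball_zero_iff] at hy
      rw [hE]
      simp only
      rw [abs_mul, abs_of_nonneg (by positivity : (0 : ℝ) ≤ (4 * π)⁻¹)]
      have h := abs_ballKernel_sub_inv_le hS (norm_nonneg y) (hy.le.trans hRS)
      calc (4 * π)⁻¹ * |(‖y‖⁻¹ - 3 / (2 * S) + ‖y‖ ^ 2 / (2 * S ^ 3)) - ‖y‖⁻¹|
          ≤ (4 * π)⁻¹ * (3 / (2 * S)) := mul_le_mul_of_nonneg_left h (by positivity)
        _ = 3 / (8 * π * S) := by field_simp; ring
    have hpt : ∀ y, Hf y * KS y = (4 * π)⁻¹ * (Hf y / ‖y‖) + Hf y * E y := by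
      intro y; rw [hKS, hE]; simp only; ring
    have hint1 : IntegrableOn (fun y => (4 * π)⁻¹ * (Hf y / ‖y‖)) (ball (0 : Space) R) :=
      (integrableOn_div_norm_ball hHm hHabs R).const_mul _
    have hint2 : IntegrableOn (fun y => Hf y * E y) (ball (0 : Space) R) := by
      refine Integrable.mono' (integrableOn_const (C := Hf 0 * (3 / (8 * π * S))) measure_ball_lt_top.ne)
        ((hHm.mul hEm).aestronglyMeasurable) ?_
      rw [ae_restrict_iff' measurableSet_ball]
      refine ae_of_all _ fun y hy => ?_
      rw [Real.norm_eq_abs, abs_mul]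
      exact mul_le_mul (hHabs y) (hEb y hy) (abs_nonneg _) hHf0
    have h1 : ∫ y in ball (0 : Space) R, Hf y * KS y =
        (4 * π)⁻¹ * (∫ y in ball (0 : Space) R, Hf y / ‖y‖) + ∫ y in ball (0 : Space) R, Hf y * E y := by
      rw [← MeasureTheory.integral_const_mul, ← integral_add hint1 hint2]
      exact integral_congr_ae (ae_of_all _ fun y => hpt y)
    have h2 : ‖∫ y in ball (0 : Space) R, Hf y * E y‖ ≤ Hf 0 * (3 / (8 * π * S)) *
        (volume : Measure Space).real (ball (0 : Space) R) := by
      refine norm_setIntegral_le_of_norm_le_const measure_ball_lt_top fun y hy => ?_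
      rw [Real.norm_eq_abs, abs_mul]
      exact mul_le_mul (hHabs y) (hEb y hy) (abs_nonneg _) hHf0
    have hvolR : (volume : Measure Space).real (ball (0 : Space) R) = 4 * π * R ^ 3 / 3 := by
      rw [Measure.real, EuclideanSpace.volume_ball_fin_three, ENNReal.toReal_mul, ENNReal.toReal_pow,
        ENNReal.toReal_ofReal hR.le, ENNReal.toReal_ofReal (by positivity)]
      ring
    rw [hvolR] at h2
    have h3 : ∫ y in ball (0 : Space) R, Hf y * E y ≤ Hf 0 * R ^ 3 / (2 * S) := by
      refine (le_abs_self _).trans ((Real.norm_eq_abs _ ▸ h2).trans (le_of_eq ?_))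
      field_simp
      ring
    have h4 : Hf 0 * R ^ 3 / (2 * S) ≤ Hf 0 * R ^ 3 / S := by
      rw [div_le_div_iff₀ (by positivity) hS]
      have : 0 ≤ Hf 0 * R ^ 3 := by positivity
      nlinarith
    linarith
  -- (D2) the shell
  have hshell : ∫ y in ball (0 : Space) S \ ball 0 R, Hf y * KS y ≤
      (4 * π)⁻¹ * (∫ y in {y : Space | R ≤ ‖y‖ ∧ ‖y‖ ≤ S}, max (Hf y) 0 / ‖y‖) := by
    set T : Set Space := {y : Space | R ≤ ‖y‖ ∧ ‖y‖ ≤ S} with hT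
    have hTm : MeasurableSet T :=
      ((isClosed_le continuous_const continuous_norm).inter
        (isClosed_le continuous_norm continuous_const)).measurableSet
    have hTsub : T ⊆ closedBall (0 : Space) S := fun y hy => mem_closedBall_zero_iff.2 hy.2
    have hTvol : volume T < ⊤ := (measure_mono hTsub).trans_lt measure_closedBall_lt_top
    have hDT : ball (0 : Space) S \ ball 0 R ⊆ T := fun y hy => by
      rw [mem_sdiff, mem_ball_zero_iff, mem_ball_zero_iff, not_lt] at hy
      exact ⟨hy.2, hy.1.le⟩
    have hDm : MeasurableSet (ball (0 : Space) S \ ball 0 R) := measurableSet_ball.diff measurableSet_ball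
    -- the target integrand is integrable on `T` (bounded by `H(0)/R`)
    have hgm : Measurable fun y : Space => (4 * π)⁻¹ * (max (Hf y) 0 / ‖y‖) :=
      ((hHm.max measurable_const).div continuous_norm.measurable).const_mul _
    have hgT : IntegrableOn (fun y : Space => (4 * π)⁻¹ * (max (Hf y) 0 / ‖y‖)) T := by
      refine Integrable.mono' (integrableOn_const (C := (4 * π)⁻¹ * (Hf 0 / R)) hTvol.ne)
        hgm.aestronglyMeasurable ?_
      rw [ae_restrict_iff' hTm]
      refine ae_of_all _ fun y hy => ?_
      have hyR : R ≤ ‖y‖ := hy.1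
      have hy0 : 0 < ‖y‖ := hR.trans_le hyR
      rw [Real.norm_eq_abs, abs_mul, abs_of_nonneg (by positivity : (0 : ℝ) ≤ (4 * π)⁻¹), abs_div,
        abs_norm, abs_of_nonneg (le_max_right _ _)]
      refine mul_le_mul_of_nonneg_left ?_ (by positivity)
      rw [div_le_div_iff₀ hy0 hR]
      have hm : max (Hf y) 0 ≤ Hf 0 := max_le (hHle y) hHf0
      have hm0 : 0 ≤ max (Hf y) 0 := le_max_right _ _
      nlinarith
    -- pointwise on the shell: `H K_S ≤ H₊/(4π|y|)`
    have hpt : ∀ y ∈ ball (0 : Space) S \ ball 0 R, Hf y * KS y ≤ (4 * π)⁻¹ * (max (Hf y) 0 / ‖y‖) := by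
      intro y hy
      have hy' := hDT hy
      have hyS : ‖y‖ ≤ S := hy'.2
      have hy0 : 0 < ‖y‖ := hR.trans_le hy'.1
      have hk0 : 0 ≤ ‖y‖⁻¹ - 3 / (2 * S) + ‖y‖ ^ 2 / (2 * S ^ 3) := ballKernel_nonneg hy0 hyS
      have hk1 : ‖y‖⁻¹ - 3 / (2 * S) + ‖y‖ ^ 2 / (2 * S ^ 3) ≤ ‖y‖⁻¹ :=
        ballKernel_le_inv hS hy0.le hyS
      have hKS0 : 0 ≤ KS y := by rw [hKS]; positivity
      rw [hKS]
      simp only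
      calc Hf y * ((4 * π)⁻¹ * (‖y‖⁻¹ - 3 / (2 * S) + ‖y‖ ^ 2 / (2 * S ^ 3)))
          ≤ max (Hf y) 0 * ((4 * π)⁻¹ * (‖y‖⁻¹ - 3 / (2 * S) + ‖y‖ ^ 2 / (2 * S ^ 3))) :=
            mul_le_mul_of_nonneg_right (le_max_left _ _) (by positivity)
        _ ≤ max (Hf y) 0 * ((4 * π)⁻¹ * ‖y‖⁻¹) :=
            mul_le_mul_of_nonneg_left (mul_le_mul_of_nonneg_left hk1 (by positivity)) (le_max_right _ _)
        _ = (4 * π)⁻¹ * (max (Hf y) 0 / ‖y‖) := by rw [div_eq_mul_inv]; ring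
    calc ∫ y in ball (0 : Space) S \ ball 0 R, Hf y * KS y
        ≤ ∫ y in ball (0 : Space) S \ ball 0 R, (4 * π)⁻¹ * (max (Hf y) 0 / ‖y‖) :=
          setIntegral_mono_on (hintS.mono_set sdiff_subset) (hgT.mono_set hDT) hDm hpt
      _ ≤ ∫ y in T, (4 * π)⁻¹ * (max (Hf y) 0 / ‖y‖) :=
          setIntegral_mono_set hgT (ae_of_all _ fun y => by positivity) hDT.eventuallyLE
      _ = (4 * π)⁻¹ * ∫ y in T, max (Hf y) 0 / ‖y‖ := MeasureTheory.integral_const_mul _ _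
  linarith

end Minorant

end Summit.AtomisticToContinuum.BoseEinsteinCondensation.Theorems.CoreContinuationKernel

end
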